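import Summits.ABC.IUTFork.Cor312StatementGenuineM
import Summits.ABC.IUTFork.Cor312ThetaSideEqualMGlobal
import Summits.ABC.IUTFork.Cor312StatementExactK
import HarnessLib

/-!
# [IUTchIII] Cor. 3.12 at the M-LEVEL genuine sharp settings — the EXACT readout of the typed Statement, and the M ↔ K agreement:
# `Statement(settingMSharp … own ideles) ⟺ I.Cor312NonarchOf ⟺ Statement(settingPrVolSharp (pilotDataOfK D K) … realising ideles)`

PROOF-ONLY file (D-0012; no definitions, no `Prop` facts) of the abc-iut cell (R2 S-chain team, seat abc-iut-s2-p7 gen 3, TARGET #2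
`hΘ … (or =)` — consequence of the nonarchimedean exactness on BOTH lines). TAKES NO SIDE on [IUTchIII] Cor. 3.12.

abc-iut-w5-d244's `statement_settingMSharp_iff_negAbsLogQ_le` / `statement_settingPrVolSharpM_iff_negAbsLogQ_le` (`Cor312StatementGenuineM`) read the
typed [IUTchIII] Cor. 3.12 `Cor312.Setting.Statement` at the M-level sharp settings of a volume input `I`'s OWN ideles (abc-iut-w5-d166's
`settingMSharp`, abc-iut-s2-p8's `settingPrVolSharpM`) as `−|log(Θ)| ≠ ⊤ ∧ ↑I.negAbsLogQ ≤ −|log(Θ)|`; abc-iut-s2-p9's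
`negLogTheta_settingMSharp_eq_negLogThetaNonarch_of_isVolumeInputOf` (`Cor312ThetaSideEqualMGlobal`, p449545) is `−|log(Θ)| = ↑I.negLogThetaNonarch`
there. HENCE (§1) `Statement ↔ I.Cor312NonarchOf` on the M line too — and with this seat's `K`-line readout
`statement_settingPrVolSharp_pilotDataOfK_iff_cor312NonarchOf` (`Cor312StatementExactK`, p453952) the two lines AGREE (§2):

* §1 **`statement_settingMSharp_genuine_iff_cor312NonarchOf`**, `statement_settingPrVolSharpM_genuine_iff_cor312NonarchOf` — for every volume input
  `I` of `D` and ANY context binders: `Statement ↔ I.Cor312NonarchOf` (Dupuy–Hilado's (1.1) for `I`); `cor312NonarchOf_of_statement_settingMSharp`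
  (strengthens abc-iut-w5-d244's `cor312Of_of_statement_settingMSharp` by the archimedean summand), `statement_settingMSharp_of_cor312NonarchOf`
  (the converse, NOT available before exactness);
* §2 **`statement_settingMSharp_genuine_iff_statement_settingPrVolSharp_pilotDataOfK`** — for every volume input `I` of `D`, the typed Statement at the
  M-level setting of `I`'s own ideles ⟺ the typed Statement at the `K`-level setting `settingPrVolSharp (pilotDataOfK D K) …` at ANY realising
  Θ- and `q`-ideles: the [C312] hypotheses `hst` of the two downstream certificates (abc-iut-C-cert-3 `abc_of_cor312Statement_genuineM` p443000,
  abc-iut-C-cert-2 `abc_of_cor312Statement_genuineK` p445044) are, per datum, THE SAME proposition — Dupuy–Hilado (1.1) for the genuine input.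

[cite: Mochizuki2012, IUTchIII Cor. 3.12 p. 173–174] [cite: Mochizuki2012, IUTchIV Thm. 1.10 p. 23; Steps (v)–(viii) p. 27–30]
[cite: DupuyHilado2025, §1 (1.1), Def. 3.6.3, Thm. 3.10.1, §4.12] [claim: Mochizuki2012, status: disputed] for every quoted construction.
HONEST FRAMING: EQUIVALENCES between OUR typings of one printed inequality at the genuine data; nothing here asserts or denies Cor. 3.12 for
any initial Θ-data or takes a side on any author; typed ≠ proved; instantiated ≠ endorsed.
-/

noncomputable section

open Set Function NumberField IsDedekindDomain

namespace Summit.ABC.IUTFork.Thm311.Real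

open Cor312 Cor312Vol Cor312Prov Literature.IUT.LogThetaLattice Literature.IUT.LogVolume Literature.IUT.HodgeTheaters
  Literature.NumberTheory.NumberFields

variable {F K Fbar : Type} [Field F] [NumberField F] [Field K] [NumberField K] [Algebra F K]
  [Field Fbar] [Algebra F Fbar] [Algebra K Fbar] {E : WeierstrassCurve F} [E.IsElliptic] {l : ℕ}
  {Pb : BadPlacePredicates K} (D : InitialThetaData F K Fbar E l Pb) {logvK : PadicLogsVal K}
  (hlog : LogvAnalyticVal logvK) {I : ThetaVolumeInput (fieldOfModuli E) K} (hI : ThetaData.IsVolumeInputOf D I)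
  (M : Type) [Field M] [NumberField M]
  (archPk : ∀ (j : (thetaIndexOfInitial D).Label) (vQ : (thetaIndexOfInitial D).VQ),
    Set ((logShellsOfInitialDH D logvK).Packet j vQ))
  (archSub : ∀ (j : (thetaIndexOfInitial D).Label) (v : (thetaIndexOfInitial D).V),
    Set ((logShellsOfInitialDH D logvK).Packet j ((thetaIndexOfInitial D).over v)))
  (Ψ : ℤ → ∀ v : (thetaIndexOfInitial D).V, v ∈ (thetaIndexOfInitial D).Vbad →
    Set ((logShellsOfInitialDH D logvK).StarPacket v))
  (act : ℤ → ∀ v : (thetaIndexOfInitial D).V, v ∈ (thetaIndexOfInitial D).Vbad →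
    (logShellsOfInitialDH D logvK).StarPacket v → Module.End ℚ ((logShellsOfInitialDH D logvK).StarPacket v))
  (Mmod : ℤ → ∀ j : (thetaIndexOfInitial D).LabelStar, Set ((logShellsOfInitialDH D logvK).GlobalPacket j.1))
  (region : ℤ → ∀ j : (thetaIndexOfInitial D).LabelStar, FinDivisor M → ∀ vQ : (thetaIndexOfInitial D).VQ,
    Set ((logShellsOfInitialDH D logvK).Packet j.1 vQ))
  (n : ℤ) {HT : Type} {LogLink : HT → HT → Type} {IsFull : ∀ {s t : HT}, LogLink s t → Prop}
  (lat : LGPGaussianLogThetaLattice LogLink IsFull)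
  {Frd : Type} {IsoF : Frd → Frd → Type} {Ob : Frd → Type} {realify : Frd → Frd} {Strip : Type}
  {IsoS : Strip → Strip → Type}
  {Mv : ∀ v : (thetaIndexOfInitial D).V, v ∈ (thetaIndexOfInitial D).Vbad → Type} [∀ v h, Monoid (Mv v h)]
  (sig : GlobalLGPFrobenioidSignature (thetaIndexOfInitial D).lstar (thetaIndexOfInitial D).V
    (· ∈ (thetaIndexOfInitial D).Vbad) Frd IsoF Ob realify Strip IsoS Mv)
  (split : SplittingMonoids Mv) {ObΔ : Type}
  {N : ∀ v : (thetaIndexOfInitial D).V, v ∈ (thetaIndexOfInitial D).Vbad → Type} [∀ v h, Monoid (N v h)]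
  (qData : QPilotData ObΔ N)
  (Sq : Finset (FinitePlace ℚ))
  (htq1 : ∀ (u : FinitePlace ℚ) (x : (thetaIndexOfInitial D).Fibre (Val.non u)), u ∉ Sq →
    ‖tqM D (ratChar u) u (natCast_ratChar_mem u) (ideleDataOf D hI) x‖ = 1)

/-! ## §1. The typed Statement at the M-level genuine settings ⟺ Dupuy–Hilado's (1.1) for the input -/

/-- **EXACT READOUT on the frames route: `Statement(settingMSharp … (tOfIdeleData D (ideleDataOf D hI)) (tqM …) …) ↔ I.Cor312NonarchOf`** for
every volume input `I` of `D` and ANY context binders (number field `M` of the global realified Frobenioid, archimedean packets, splitting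
monoids / lattice / link data, Kummer column `n`, any finite `Sq` off which the `q`-ideles are units): abc-iut-w5-d244's number-level reformulation
`statement_settingMSharp_iff_negAbsLogQ_le` and abc-iut-s2-p9's exactness `negLogTheta_settingMSharp_eq_negLogThetaNonarch_of_isVolumeInputOf`.
Both sides are CLAIM forms; neither is asserted. [cite: Mochizuki2012, IUTchIII Cor. 3.12 p. 173–174] [cite: DupuyHilado2025, §1 (1.1)] -/
theorem statement_settingMSharp_genuine_iff_cor312NonarchOf :
    (settingMSharp D hlog M archPk archSub Ψ act Mmod region n lat sig split qData (tOfIdeleData D (ideleDataOf D hI))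
        (fun u x => tqM D (ratChar u) u (natCast_ratChar_mem u) (ideleDataOf D hI) x)
        (fun u x => tqM_ne_zero D (ratChar u) u (natCast_ratChar_mem u) (ideleDataOf D hI) x) Sq htq1).Statement ↔
      I.Cor312NonarchOf := by
  rw [statement_settingMSharp_iff_negAbsLogQ_le D hlog hI M archPk archSub Ψ act Mmod region n lat sig split qData Sq htq1,
    negLogTheta_settingMSharp_eq_negLogThetaNonarch_of_isVolumeInputOf D hlog
      (fun u x => tqM D (ratChar u) u (natCast_ratChar_mem u) (ideleDataOf D hI) x) M archPk archSub Ψ act Mmod region n lat sig split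
      qData (fun u x => tqM_ne_zero D (ratChar u) u (natCast_ratChar_mem u) (ideleDataOf D hI) x) Sq htq1 hI,
    WithTop.coe_le_coe]
  exact ⟨fun h => h.2, fun h => ⟨WithTop.coe_ne_top, h⟩⟩

/-- **… and on the summand route: `Statement(settingPrVolSharpM … (tOfIdeleData D (ideleDataOf D hI)) (tqM …) …) ↔ I.Cor312NonarchOf`**
(abc-iut-w4-d013's two-routes identity `statement_settingMSharp_iff_settingPrVolSharpM`). [cite: Mochizuki2012, IUTchIII Cor. 3.12 p. 173–174]
[cite: DupuyHilado2025, §1 (1.1)] -/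
theorem statement_settingPrVolSharpM_genuine_iff_cor312NonarchOf :
    (settingPrVolSharpM D hlog (tOfIdeleData D (ideleDataOf D hI))
        (fun u x => tqM D (ratChar u) u (natCast_ratChar_mem u) (ideleDataOf D hI) x) M archPk archSub Ψ act Mmod region n lat sig split
        qData (fun u x => tqM_ne_zero D (ratChar u) u (natCast_ratChar_mem u) (ideleDataOf D hI) x) Sq htq1).Statement ↔
      I.Cor312NonarchOf := by
  rw [← statement_settingMSharp_iff_settingPrVolSharpM]
  exact statement_settingMSharp_genuine_iff_cor312NonarchOf D hlog hI M archPk archSub Ψ act Mmod region n lat sig split qData Sq htq1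

/-- **`hst ⟹ I.Cor312NonarchOf` on the M line** — the typed Statement at the frames-route M-level genuine setting yields Dupuy–Hilado's (1.1)
for the input, STRONGER than abc-iut-w5-d244's `cor312Of_of_statement_settingMSharp` (`⟹ I.Cor312Of`) by the archimedean summand.
[cite: Mochizuki2012, IUTchIII Cor. 3.12 p. 173–174] [cite: DupuyHilado2025, §1 (1.1)] -/
theorem cor312NonarchOf_of_statement_settingMSharp
    (hst : (settingMSharp D hlog M archPk archSub Ψ act Mmod region n lat sig split qData (tOfIdeleData D (ideleDataOf D hI))
        (fun u x => tqM D (ratChar u) u (natCast_ratChar_mem u) (ideleDataOf D hI) x)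
        (fun u x => tqM_ne_zero D (ratChar u) u (natCast_ratChar_mem u) (ideleDataOf D hI) x) Sq htq1).Statement) :
    I.Cor312NonarchOf :=
  (statement_settingMSharp_genuine_iff_cor312NonarchOf D hlog hI M archPk archSub Ψ act Mmod region n lat sig split qData Sq htq1).mp hst

/-- **`hst ⟹ I.Cor312NonarchOf` on the summand route.** [cite: Mochizuki2012, IUTchIII Cor. 3.12 p. 173–174] [cite: DupuyHilado2025, §1 (1.1)] -/
theorem cor312NonarchOf_of_statement_settingPrVolSharpM
    (hst : (settingPrVolSharpM D hlog (tOfIdeleData D (ideleDataOf D hI))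
        (fun u x => tqM D (ratChar u) u (natCast_ratChar_mem u) (ideleDataOf D hI) x) M archPk archSub Ψ act Mmod region n lat sig split
        qData (fun u x => tqM_ne_zero D (ratChar u) u (natCast_ratChar_mem u) (ideleDataOf D hI) x) Sq htq1).Statement) :
    I.Cor312NonarchOf :=
  (statement_settingPrVolSharpM_genuine_iff_cor312NonarchOf D hlog hI M archPk archSub Ψ act Mmod region n lat sig split qData Sq
    htq1).mp hst

/-- **The converse on the M line** (NOT available before exactness — abc-iut-w5-d244's record stated «the converse is NOT claimed (the Θ-side
identification is one-sided)»; it now IS two-sided): Dupuy–Hilado's (1.1) for the input ⟹ the typed Statement at the frames-route M-level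
genuine setting, ANY context binders. [cite: Mochizuki2012, IUTchIII Cor. 3.12 p. 173–174] [cite: DupuyHilado2025, §1 (1.1)] -/
theorem statement_settingMSharp_of_cor312NonarchOf (h : I.Cor312NonarchOf) :
    (settingMSharp D hlog M archPk archSub Ψ act Mmod region n lat sig split qData (tOfIdeleData D (ideleDataOf D hI))
        (fun u x => tqM D (ratChar u) u (natCast_ratChar_mem u) (ideleDataOf D hI) x)
        (fun u x => tqM_ne_zero D (ratChar u) u (natCast_ratChar_mem u) (ideleDataOf D hI) x) Sq htq1).Statement :=
  (statement_settingMSharp_genuine_iff_cor312NonarchOf D hlog hI M archPk archSub Ψ act Mmod region n lat sig split qData Sq htq1).mpr h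

/-! ## §2. The M line and the `K` line carry THE SAME [C312] hypothesis per datum -/

/-- **M ↔ K AGREEMENT of the typed [IUTchIII] Cor. 3.12 Statements**: for every volume input `I` of the initial Θ-data `D`, the typed Statement at
abc-iut-w5-d166's M-level sharp setting of `I`'s OWN ideles (ANY M-side context binders) holds IFF the typed Statement at abc-iut-c312-7's `K`-level
sharp setting `settingPrVolSharp (pilotDataOfK D K) …` holds at ANY realising Θ-idele `t` and realising `q`-idele `tq` (ANY `K`-side context binders):
both are Dupuy–Hilado's (1.1) for `I` (§1 and abc-iut-s2-p7's `statement_settingPrVolSharp_pilotDataOfK_iff_cor312NonarchOf`, p453952). So the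
[C312] hypotheses of abc-iut-C-cert-3's `abc_of_cor312Statement_genuineM` (p443000) and abc-iut-C-cert-2's `abc_of_cor312Statement_genuineK` (p445044)
are, per datum, ONE proposition. [cite: Mochizuki2012, IUTchIII Cor. 3.12 p. 173–174] [cite: DupuyHilado2025, §1 (1.1)] -/
theorem statement_settingMSharp_genuine_iff_statement_settingPrVolSharp_pilotDataOfK
    (MK : Type) [Field MK] [NumberField MK]
    (archPkK : ∀ (j : (thetaIndex (pilotDataOfK D K)).Label) (vQ : (thetaIndex (pilotDataOfK D K)).VQ),
      Set ((logShellsDH (pilotDataOfK D K) (analyticLogv K)).Packet j vQ))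
    (archSubK : ∀ (j : (thetaIndex (pilotDataOfK D K)).Label) (v : (thetaIndex (pilotDataOfK D K)).V),
      Set ((logShellsDH (pilotDataOfK D K) (analyticLogv K)).Packet j ((thetaIndex (pilotDataOfK D K)).over v)))
    (ΨK : ℤ → ∀ v : (thetaIndex (pilotDataOfK D K)).V, v ∈ (thetaIndex (pilotDataOfK D K)).Vbad →
      Set ((logShellsDH (pilotDataOfK D K) (analyticLogv K)).StarPacket v))
    (actK : ℤ → ∀ v : (thetaIndex (pilotDataOfK D K)).V, v ∈ (thetaIndex (pilotDataOfK D K)).Vbad →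
      (logShellsDH (pilotDataOfK D K) (analyticLogv K)).StarPacket v →
        Module.End ℚ ((logShellsDH (pilotDataOfK D K) (analyticLogv K)).StarPacket v))
    (MmodK : ℤ → ∀ j : (thetaIndex (pilotDataOfK D K)).LabelStar,
      Set ((logShellsDH (pilotDataOfK D K) (analyticLogv K)).GlobalPacket j.1))
    (regionK : ℤ → ∀ j : (thetaIndex (pilotDataOfK D K)).LabelStar, FinDivisor MK → ∀ vQ : (thetaIndex (pilotDataOfK D K)).VQ,
      Set ((logShellsDH (pilotDataOfK D K) (analyticLogv K)).Packet j.1 vQ))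
    (nK : ℤ) {HTK : Type} {LogLinkK : HTK → HTK → Type} {IsFullK : ∀ {s t : HTK}, LogLinkK s t → Prop}
    (latK : LGPGaussianLogThetaLattice LogLinkK IsFullK)
    {FrdK : Type} {IsoFK : FrdK → FrdK → Type} {ObK : FrdK → Type} {realifyK : FrdK → FrdK} {StripK : Type}
    {IsoSK : StripK → StripK → Type}
    {MvK : ∀ v : (thetaIndex (pilotDataOfK D K)).V, v ∈ (thetaIndex (pilotDataOfK D K)).Vbad → Type} [∀ v h, Monoid (MvK v h)]
    (sigK : GlobalLGPFrobenioidSignature (thetaIndex (pilotDataOfK D K)).lstar (thetaIndex (pilotDataOfK D K)).V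
      (· ∈ (thetaIndex (pilotDataOfK D K)).Vbad) FrdK IsoFK ObK realifyK StripK IsoSK MvK)
    (splitK : SplittingMonoids MvK) {ObΔK : Type}
    {NK : ∀ v : (thetaIndex (pilotDataOfK D K)).V, v ∈ (thetaIndex (pilotDataOfK D K)).Vbad → Type} [∀ v h, Monoid (NK v h)]
    (qDataK : QPilotData ObΔK NK)
    (tq : ∀ (pp : Nat.Primes) (x : (thetaIndex (pilotDataOfK D K)).Fibre (.inr pp)),
      haveI : Fact (pp : ℕ).Prime := ⟨pp.2⟩; kOf (pilotDataOfK D K) pp.1 x)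
    (t : ∀ (pp : Nat.Primes) (_ : Fin (pilotDataOfK D K).lstar) (x : (thetaIndex (pilotDataOfK D K)).Fibre (.inr pp)),
      haveI : Fact (pp : ℕ).Prime := ⟨pp.2⟩; kOf (pilotDataOfK D K) pp.1 x)
    (htq0 : ∀ pp x, tq pp x ≠ 0)
    (htq1K : ∀ (pp : Nat.Primes) (x : (thetaIndex (pilotDataOfK D K)).Fibre (.inr pp)),
      haveI : Fact (pp : ℕ).Prime := ⟨pp.2⟩; placeOf (pilotDataOfK D K) pp.1 x ∉ (pilotDataOfK D K).S → ‖tq pp x‖ = 1)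
    (ht0 : ∀ pp i x, t pp i x ≠ 0)
    (hT : ∀ (pp : Nat.Primes) (i : Fin (pilotDataOfK D K).lstar) (x : (thetaIndex (pilotDataOfK D K)).Fibre (.inr pp)),
      haveI : Fact (pp : ℕ).Prime := ⟨pp.2⟩
      Real.log ‖t pp i x‖ = -((pilotDataOfK D K).thetaPilot i (placeOf (pilotDataOfK D K) pp.1 x)) *
        logNorm K (placeOf (pilotDataOfK D K) pp.1 x) / localDegree K (placeOf (pilotDataOfK D K) pp.1 x))
    (htq : ∀ (pp : Nat.Primes) (x : (thetaIndex (pilotDataOfK D K)).Fibre (.inr pp)),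
      haveI : Fact (pp : ℕ).Prime := ⟨pp.2⟩
      Real.log ‖tq pp x‖ = -((pilotDataOfK D K).qPilot (placeOf (pilotDataOfK D K) pp.1 x)) *
        logNorm K (placeOf (pilotDataOfK D K) pp.1 x) / localDegree K (placeOf (pilotDataOfK D K) pp.1 x)) :
    (settingMSharp D hlog M archPk archSub Ψ act Mmod region n lat sig split qData (tOfIdeleData D (ideleDataOf D hI))
        (fun u x => tqM D (ratChar u) u (natCast_ratChar_mem u) (ideleDataOf D hI) x)
        (fun u x => tqM_ne_zero D (ratChar u) u (natCast_ratChar_mem u) (ideleDataOf D hI) x) Sq htq1).Statement ↔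
      (settingPrVolSharp (pilotDataOfK D K) (logvAnalytic_analyticLogv (F := K)) MK archPkK archSubK ΨK actK MmodK regionK nK latK sigK
        splitK qDataK tq t htq0 htq1K).Statement := by
  rw [statement_settingMSharp_genuine_iff_cor312NonarchOf D hlog hI M archPk archSub Ψ act Mmod region n lat sig split qData Sq htq1,
    statement_settingPrVolSharp_pilotDataOfK_iff_cor312NonarchOf D MK archPkK archSubK ΨK actK MmodK regionK nK latK sigK splitK qDataK tq
      t htq0 htq1K ht0 hT htq hI]

end Summit.ABC.IUTFork.Thm311.Real

end
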